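import Summits.ABC.ABC.Theses.AntisymmetricTwoTorsion
import Summits.ABC.ABC.Theorems.AntisymmetricTwoTorsionTraceDefectPayoff
import Summits.ABC.ABC.Theorems.TwoTorsionDictionary
import Summits.ABC.ABC.Theorems.SubexponentialAbcWithoutRadAHolds
import HarnessLib

/-!
# Route `AntisymmetricTwoTorsion` — target `TraceDefectSubexpSzpiro` (stmt-ABC-23394)

**Subexponential Szpiro up to a trace defect on the antisymmetric two-torsion class**,
unconditionally: for every `ε > 0` there is `C` such that for all coprime `a, b` with
`b (a² − 4b) ≠ 0`, NOT (`b > 0 ∧ a² − 4b > 0`), and every elliptic `W = ⟨0, a, 0, b, 0⟩ / ℚ`,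

  `log |Δ_min (W)| ≤ 12 · log (1 + |a|) + C · N_W ^ ε`.

Assembly of the line, every input PROVED in the tree: the engine
`RadAFreeEngine = PastenSepulvedaManzo2025_thm_2_2` holds unconditionally
(`Summit.ABC.ABC.Theorems.pastenSepulvedaManzo2025_thm_2_2_holds`, from the A1.L rung
`approximationBound_rat_holds`); the dictionary is `twoTorsionDictionary_proof`; the payoff is
`traceDefectPayoff_proof`.

HONESTY. This is a class corollary at rung A1′ (subexponential Szpiro) UP TO THE DEFECT
`12 log (1 + |a|)` on a thin two-parameter class — NOT abc, NOT A-PS, and not the rung A1′ itself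
(the off-class residual `OffClassResidual` is declared, not claimed); it moves no rung of
LADDER-ABC. Its trust base is the kernel plus the whitelisted axioms (no named-fact hypothesis).

## References

* H. Pasten, R. Sepúlveda-Manzo, Bull. Braz. Math. Soc. 56 (2025) = arXiv:2406.05083, Thm 2.2.
  [PastenSepulvedaManzo2025Abcd]
* J. H. Silverman, *The Arithmetic of Elliptic Curves*, 2nd ed. 2009, VII.1, VII.5, VIII.8.
  [SilvermanAEC2009]
-/

-- `Summit.<Summit>.<Problem>` is the mandated summit-side namespace (CONVENTIONS §2); for the
-- single-conjunct summit `ABC` the two coincide, so the duplicate `ABC.ABC` is deliberate.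
set_option linter.dupNamespace false

namespace Summit.ABC.ABC.Theorems

/-- **Closes stmt-ABC-23394** (target of route `AntisymmetricTwoTorsion`), unconditionally:
`Summit.ABC.ABC.Theses.AntisymmetricTwoTorsion.TraceDefectSubexpSzpiro` — subexponential Szpiro
up to the trace defect `12 log (1 + |a|)` on the antisymmetric two-torsion class, from
Pasten–Sepúlveda-Manzo 2025 Thm 2.2 (proved in the tree), the two-torsion dictionary and the
payoff. NOT abc, NOT A-PS; class corollary; moves no rung.
[cite: PastenSepulvedaManzo2025Abcd, Thm 2.2] -/
theorem traceDefectSubexpSzpiro_proof :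
    Summit.ABC.ABC.Theses.AntisymmetricTwoTorsion.TraceDefectSubexpSzpiro :=
  traceDefectPayoff_proof pastenSepulvedaManzo2025_thm_2_2_holds twoTorsionDictionary_proof

end Summit.ABC.ABC.Theorems
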